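import Summits.Ventures.HSemireg.WedgeHankelPairMixing
import Summits.Ventures.HSemireg.WedgeHankelSiegelIdealFN4
import Summits.Ventures.HSemireg.WedgeHankelSubstitutionSiegel

/-!
# Venture HSemireg — THE SIEGEL SPACE AND THE SIEGEL IDEAL ARE STABLE UNDER EVERY PAIR MIXING `Pm M`, SINGULAR `M` INCLUDED: `x(u) ∧ y(u) ∈ Siegel_n` for every `u ∈ Kⁿ`,
# polarization gives `x(u) ∧ y(v) + x(v) ∧ y(u)`, and `Pm M (s_{ab}) = x(m_a) ∧ y(m_b) + x(m_b) ∧ y(m_a)` (the Siegel space is the `Sym²` of the pairs; no `det M ≠ 0`, no `2 ∈ Kˣ`)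

HONEST FRAMING. Part of the Lean index of the computation cell `pub-hsemireg` (seat p10 gen 19, Sunday typer «UNIFORM-IN-n»).
Finite-dimensional EXTERIOR ALGEBRA over a field ONLY: no variety, no cohomology theory, no sheaf, no Ext group, no semiregularity map;
nothing here says that HC / HC_CM / HC_AV holds; no Literature fact is declared or used.  Custodian versions as in `WedgeHankelSiegelIdeal` (1/3); the dictionary (the pairs `(x_a, y_a)`;
`Pm M` = a linear change of the `n` factors, not necessarily invertible; the Siegel space = `Sym²` of the standard representation inside `⋀²(Kⁿ ⊕ Kⁿ)`) is QUOTED, never asserted.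

WHAT IS IN THE TREE.  H9 `WedgeHankelPairMixing` (914): `Pm M := ExteriorAlgebra.map (pmLin M)` for EVERY `M ∈ M_n(K)` (`Pm_X`: `Pm M x_a = Σ_c M_{ca} x_c`, `Pm_Y`, `Pm_mul`); H9b (924):
for `det M ≠ 0` the automorphism `PmE` maps `SI_k` ONTO `SI_k` (`map_PmE_siegelIdeal`, via G6's `SI_k = ⋂_q Kr(univ, w_n q, k)` and `Pm M (w_n q) = det M · w_n q`) — an argument that says
nothing for SINGULAR `M` (then `Pm M` kills every class).  Gen 10/11: `sv a b` (`s_{ab} = x_a y_b + x_b y_a`, `s_{aa} = x_a y_a`), `siegel K n = span{s_{ab} : a ≤ b < n}`, `siegelIdeal K n k`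
(`SI_k = span{E_t ∧ s_{ab}}`), `siegelIdeal_two`, FN4's two-sided ideal property `exteriorPower_mul_siegelIdeal_le`.  THIS FILE removes `det M ≠ 0` (namespace
`Summit.Ventures.HSemireg.Wedge.HankelPairMixing` continued):
* §167 `sv_comm`, **`sv_mem_siegel`** (`a, b < n`, any order); **`sum_X_mul_sum_Y_mem_siegel`: `x(u) ∧ y(u) := (Σ_c u_c x_c) ∧ (Σ_c u_c y_c) ∈ Siegel_n` for EVERY `u ∈ Kⁿ`** (Finset
  induction on the support: the cross terms pair up into `Σ_{a ∈ S} u_b u_a · s_{ab}`), and by POLARIZATION (no division by `2`) **`sum_X_mul_sum_Y_add_mem_siegel`: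
  `x(u) ∧ y(v) + x(v) ∧ y(u) ∈ Siegel_n`**.
* §168 `Pm_sum_smul_X` / `Pm_sum_smul_Y` (`Pm M x(u) = x(Mu)`), `Pm_X_mul_Y` (`Pm M (x_a ∧ y_b) = x(m_a) ∧ y(m_b)`, `m_a` = column `a`), **`Pm_sv_mem_siegel`** and
  **`map_Pm_siegel_le`: `Pm M (Siegel_n) ≤ Siegel_n` for EVERY `M`**; `Pm_sum_X_mul_sum_Y` (`Pm M (x(u) ∧ y(v)) = x(Mu) ∧ y(Mv)`: `Pm` acts on the Siegel space as `Sym² M`).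
* §169 `map_Pm_exteriorPower_le` / `Pm_mem_exteriorPower` (degrees are kept), `B_mem_exteriorPower_card`, `Pm_igen_mem_siegelIdeal`, and **`map_Pm_siegelIdeal_le`: `Pm M (SI_k) ≤ SI_k` for EVERY `M` and EVERY
  `k`** (`E_t ∧ s_{ab} ↦ Pm M(E_t) ∧ Pm M(s_{ab}) ∈ ⋀^{k−2} ∧ SI_2 ⊆ SI_k`); `Pm_mem_siegelIdeal`, **`Pm_mul_w_eq_zero_of_mem_siegelIdeal`** (`Pm M θ ∧ w_n(q) = 0` for `θ ∈ SI_k`, every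
  `M`, `q`).  With H1b's `map_Sb_siegelIdeal_le` the Siegel ideal is stable under the whole monoid `M₂(K) × M_n(K)` (`Sb_Pm_mem_siegelIdeal`).
NOT typed here: equality `Pm M (SI_k) = SI_k ∩ (image)` for singular `M`; the co-Siegel spaces under singular `Pm` (they are spanned by classes, which `Pm M` kills when `det M = 0`);
anything Ext-side.  Class side only; new names only.
-/

open Module

namespace Summit.Ventures.HSemireg.Wedge.HankelPairMixing

open Summit.Ventures.HSemireg.Wedge Summit.Ventures.HSemireg.Wedge.Kunneth Summit.Ventures.HSemireg.Wedge.Hankel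
  Summit.Ventures.HSemireg.Wedge.HankelSiegel Summit.Ventures.HSemireg.Wedge.HankelSiegelIdeal Summit.Ventures.HSemireg.Wedge.KunnethKernel
  Summit.Ventures.HSemireg.Wedge.HankelFrameChange

variable (K : Type*) [Field K] {n : ℕ}

/-! ## §167. `x(u) ∧ y(u)` lies in the Siegel space, and polarization -/

/-- `s_{ab} = s_{ba}`. -/
lemma sv_comm (a b : ℕ) : sv K (n := n) a b = sv K b a := by
  by_cases h : a = b
  · rw [h]
  · rw [sv, sv, if_neg h, if_neg (Ne.symm h), add_comm]

/-- **`s_{ab} ∈ Siegel_n` for all `a, b < n`** (in either order). -/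
theorem sv_mem_siegel {a b : ℕ} (ha : a < n) (hb : b < n) : sv K (n := n) a b ∈ siegel K n := by
  rcases le_or_gt a b with h | h
  · exact Submodule.subset_span ⟨⟨⟨b, hb⟩, ⟨a, Nat.lt_succ_of_le h⟩⟩, rfl⟩
  · rw [sv_comm]
    exact Submodule.subset_span ⟨⟨⟨a, ha⟩, ⟨b, Nat.lt_succ_of_le h.le⟩⟩, rfl⟩

/-- `x_b ∧ x_b`-free cross terms: `(u_b x_b) ∧ (Σ_{a ∈ S} u_a y_a) + (Σ_{a ∈ S} u_a x_a) ∧ (u_b y_b) = Σ_{a ∈ S} (u_b u_a)·s_{ab}` for `b ∉ S`. -/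
lemma cross_terms_eq_sum_sv (u : Fin n → K) {b : Fin n} {S : Finset (Fin n)} (hb : b ∉ S) :
    (u b • X K n b) * (∑ a ∈ S, u a • Y K n a) + (∑ a ∈ S, u a • X K n a) * (u b • Y K n b) = ∑ a ∈ S, (u b * u a) • sv K (n := n) a b := by
  rw [Finset.mul_sum, Finset.sum_mul, ← Finset.sum_add_distrib]
  refine Finset.sum_congr rfl fun a ha => ?_
  have hab : (a : ℕ) ≠ (b : ℕ) := fun e => hb (Fin.ext e ▸ ha)
  rw [sv, if_neg hab, smul_add, smul_mul_smul_comm, smul_mul_smul_comm, mul_comm (u a) (u b), add_comm]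

/-- the support-restricted form of the next theorem: `(Σ_{c ∈ S} u_c x_c) ∧ (Σ_{c ∈ S} u_c y_c) ∈ Siegel_n`. -/
theorem sum_X_mul_sum_Y_mem_siegel_finset (u : Fin n → K) (S : Finset (Fin n)) :
    (∑ c ∈ S, u c • X K n c) * (∑ c ∈ S, u c • Y K n c) ∈ siegel K n := by
  classical
  induction S using Finset.induction_on with
  | empty => rw [Finset.sum_empty, zero_mul]; exact Submodule.zero_mem _
  | insert b S hb ih =>
    rw [Finset.sum_insert hb, Finset.sum_insert hb]
    have e : (u b • X K n b + ∑ c ∈ S, u c • X K n c) * (u b • Y K n b + ∑ c ∈ S, u c • Y K n c) =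
        (u b • X K n b) * (u b • Y K n b) + ((u b • X K n b) * (∑ a ∈ S, u a • Y K n a) + (∑ a ∈ S, u a • X K n a) * (u b • Y K n b)) +
          (∑ c ∈ S, u c • X K n c) * (∑ c ∈ S, u c • Y K n c) := by
      simp only [add_mul, mul_add]; abel
    rw [e, cross_terms_eq_sum_sv K u hb]
    refine Submodule.add_mem _ (Submodule.add_mem _ ?_ (Submodule.sum_mem _ fun a _ => Submodule.smul_mem _ _ (sv_mem_siegel K a.2 b.2))) ih
    rw [smul_mul_smul_comm]
    refine Submodule.smul_mem _ _ ?_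
    have hs : sv K (n := n) b b = X K n b * Y K n b := by rw [sv, if_pos rfl, add_zero]
    rw [← hs]
    exact sv_mem_siegel K b.2 b.2

/-- **`x(u) ∧ y(u) ∈ Siegel_n` FOR EVERY `u ∈ Kⁿ`**, `x(u) = Σ_c u_c x_c`, `y(u) = Σ_c u_c y_c` (`= Σ_a u_a² s_{aa} + Σ_{a<b} u_a u_b s_{ab}`; no division by `2` used). -/
theorem sum_X_mul_sum_Y_mem_siegel (u : Fin n → K) : (∑ c, u c • X K n c) * (∑ c, u c • Y K n c) ∈ siegel K n :=
  sum_X_mul_sum_Y_mem_siegel_finset K u Finset.univ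

/-- **POLARIZATION: `x(u) ∧ y(v) + x(v) ∧ y(u) ∈ Siegel_n`** for all `u, v ∈ Kⁿ` (`= x(u+v) ∧ y(u+v) − x(u) ∧ y(u) − x(v) ∧ y(v)`). -/
theorem sum_X_mul_sum_Y_add_mem_siegel (u v : Fin n → K) :
    (∑ c, u c • X K n c) * (∑ c, v c • Y K n c) + (∑ c, v c • X K n c) * (∑ c, u c • Y K n c) ∈ siegel K n := by
  have hx : (∑ c, (u c + v c) • X K n c) = (∑ c, u c • X K n c) + ∑ c, v c • X K n c := by simp only [add_smul, Finset.sum_add_distrib]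
  have hy : (∑ c, (u c + v c) • Y K n c) = (∑ c, u c • Y K n c) + ∑ c, v c • Y K n c := by simp only [add_smul, Finset.sum_add_distrib]
  have h := sum_X_mul_sum_Y_mem_siegel K (fun c => u c + v c)
  rw [hx, hy, add_mul, mul_add, mul_add] at h
  have e : (∑ c, u c • X K n c) * (∑ c, v c • Y K n c) + (∑ c, v c • X K n c) * (∑ c, u c • Y K n c) =
      ((∑ c, u c • X K n c) * (∑ c, u c • Y K n c) + (∑ c, u c • X K n c) * (∑ c, v c • Y K n c) +
        ((∑ c, v c • X K n c) * (∑ c, u c • Y K n c) + (∑ c, v c • X K n c) * (∑ c, v c • Y K n c))) -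
      (∑ c, u c • X K n c) * (∑ c, u c • Y K n c) - (∑ c, v c • X K n c) * (∑ c, v c • Y K n c) := by abel
  rw [e]
  exact Submodule.sub_mem _ (Submodule.sub_mem _ h (sum_X_mul_sum_Y_mem_siegel K u)) (sum_X_mul_sum_Y_mem_siegel K v)

/-! ## §168. The Siegel space is stable under every pair mixing -/

/-- **`Pm M x(u) = x(Mu)`.** -/
theorem Pm_sum_smul_X (M : Matrix (Fin n) (Fin n) K) (u : Fin n → K) : Pm K M (∑ c, u c • X K n c) = ∑ c, (M.mulVec u) c • X K n c := by
  rw [map_sum]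
  simp_rw [map_smul, Pm_X, Finset.smul_sum, smul_smul]
  rw [Finset.sum_comm]
  refine Finset.sum_congr rfl fun c _ => ?_
  rw [← Finset.sum_smul, Matrix.mulVec, dotProduct]
  exact congrArg (· • X K n c) (Finset.sum_congr rfl fun a _ => mul_comm _ _)

/-- **`Pm M y(u) = y(Mu)`.** -/
theorem Pm_sum_smul_Y (M : Matrix (Fin n) (Fin n) K) (u : Fin n → K) : Pm K M (∑ c, u c • Y K n c) = ∑ c, (M.mulVec u) c • Y K n c := by
  rw [map_sum]
  simp_rw [map_smul, Pm_Y, Finset.smul_sum, smul_smul]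
  rw [Finset.sum_comm]
  refine Finset.sum_congr rfl fun c _ => ?_
  rw [← Finset.sum_smul, Matrix.mulVec, dotProduct]
  exact congrArg (· • Y K n c) (Finset.sum_congr rfl fun a _ => mul_comm _ _)

/-- **`Pm M (x(u) ∧ y(v)) = x(Mu) ∧ y(Mv)`** — on the Siegel space `Pm M` is `Sym² M` (dictionary quoted). -/
theorem Pm_sum_X_mul_sum_Y (M : Matrix (Fin n) (Fin n) K) (u v : Fin n → K) :
    Pm K M ((∑ c, u c • X K n c) * (∑ c, v c • Y K n c)) = (∑ c, (M.mulVec u) c • X K n c) * (∑ c, (M.mulVec v) c • Y K n c) := by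
  rw [map_mul, Pm_sum_smul_X, Pm_sum_smul_Y]

/-- `Pm M (x_a ∧ y_b) = x(m_a) ∧ y(m_b)` with `m_a` the column `a` of `M` (`a, b < n`). -/
theorem Pm_X_mul_Y (M : Matrix (Fin n) (Fin n) K) {a b : ℕ} (ha : a < n) (hb : b < n) :
    Pm K M (X K n a * Y K n b) = (∑ c, M c ⟨a, ha⟩ • X K n c) * (∑ c, M c ⟨b, hb⟩ • Y K n c) := by
  rw [map_mul, Pm_X' K M a ha, Pm_Y' K M b hb]

/-- **`Pm M (s_{ab}) ∈ Siegel_n` for EVERY `M`** (`a, b < n`): `= x(m_a) ∧ y(m_a)` for `a = b`, `= x(m_a) ∧ y(m_b) + x(m_b) ∧ y(m_a)` for `a ≠ b`. -/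
theorem Pm_sv_mem_siegel (M : Matrix (Fin n) (Fin n) K) {a b : ℕ} (ha : a < n) (hb : b < n) : Pm K M (sv K (n := n) a b) ∈ siegel K n := by
  by_cases h : a = b
  · subst h
    rw [sv, if_pos rfl, add_zero, Pm_X_mul_Y K M ha ha]
    exact sum_X_mul_sum_Y_mem_siegel K _
  · rw [sv, if_neg h, map_add, Pm_X_mul_Y K M ha hb, Pm_X_mul_Y K M hb ha]
    exact sum_X_mul_sum_Y_add_mem_siegel K _ _

/-- **THE SIEGEL SPACE IS STABLE UNDER EVERY PAIR MIXING: `Pm M (Siegel_n) ≤ Siegel_n`** (no `det M ≠ 0`). -/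
theorem map_Pm_siegel_le (M : Matrix (Fin n) (Fin n) K) : (siegel K n).map (Pm K M).toLinearMap ≤ siegel K n := by
  rw [siegel, Submodule.map_span, Submodule.span_le]
  rintro _ ⟨_, ⟨p, rfl⟩, rfl⟩
  rw [SetLike.mem_coe, AlgHom.toLinearMap_apply, sgen]
  exact Pm_sv_mem_siegel K M (SIdx_lt p).1 (SIdx_lt p).2

/-- membership form. -/
theorem Pm_mem_siegel (M : Matrix (Fin n) (Fin n) K) {θ : HT K (In n)} (hθ : θ ∈ siegel K n) : Pm K M θ ∈ siegel K n :=
  map_Pm_siegel_le K M ⟨θ, hθ, rfl⟩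

/-! ## §169. The Siegel ideal is stable under every pair mixing -/

/-- **every pair mixing maps `⋀^k` into `⋀^k`** (`ιMulti v ↦ ιMulti (pmLin M ∘ v)`). -/
theorem map_Pm_exteriorPower_le (M : Matrix (Fin n) (Fin n) K) (k : ℕ) : (⋀[K]^k (In n → K)).map (Pm K (n := n) M).toLinearMap ≤ ⋀[K]^k (In n → K) := by
  rw [← ExteriorAlgebra.ιMulti_span_fixedDegree K k, Submodule.map_span, Submodule.span_le]
  rintro _ ⟨_, ⟨v, rfl⟩, rfl⟩
  rw [SetLike.mem_coe, AlgHom.toLinearMap_apply, Pm, ExteriorAlgebra.map_apply_ιMulti]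
  exact Submodule.subset_span ⟨_, rfl⟩

/-- membership form. -/
lemma Pm_mem_exteriorPower (M : Matrix (Fin n) (Fin n) K) {k : ℕ} {θ : HT K (In n)} (hθ : θ ∈ ⋀[K]^k (In n → K)) : Pm K M θ ∈ ⋀[K]^k (In n → K) :=
  map_Pm_exteriorPower_le K M k ⟨θ, hθ, rfl⟩

/-- a monomial of cardinality `k` lies in `⋀^k` (via `Hom(univ, k)`). -/
lemma B_mem_exteriorPower_card (t : Finset (In n)) : B K (In n) t ∈ ⋀[K]^(t.card) (In n → K) := by
  rw [exteriorPower_eq_Hom_univ]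
  exact B_mem_Hom K (Finset.subset_univ t) rfl

/-- a generator `E_t ∧ s_{ab}` of `SI_k` goes to `Pm M(E_t) ∧ Pm M(s_{ab}) ∈ ⋀^{|t|} ∧ SI_2 ⊆ SI_k`. -/
theorem Pm_igen_mem_siegelIdeal (M : Matrix (Fin n) (Fin n) K) {k : ℕ} (p : IIdx n k) : Pm K M (igen K p) ∈ siegelIdeal K n k := by
  obtain ⟨⟨t, ht⟩, s⟩ := p
  subst ht
  rw [igen, map_mul]
  have h1 : Pm K M (B K (In n) t) ∈ ⋀[K]^(t.card) (In n → K) := Pm_mem_exteriorPower K M (B_mem_exteriorPower_card K t)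
  have h2 : Pm K M (sgen K s) ∈ siegelIdeal K n 2 := by
    rw [siegelIdeal_two, sgen]
    exact Pm_sv_mem_siegel K M (SIdx_lt s).1 (SIdx_lt s).2
  exact (exteriorPower_mul_siegelIdeal_le K (n := n) t.card 2).1 (Submodule.mul_mem_mul h1 h2)

/-- **THE SIEGEL IDEAL IS STABLE UNDER EVERY PAIR MIXING: `Pm M (SI_k) ≤ SI_k` for EVERY `M ∈ M_n(K)` and every `k`** — `E_t ∧ s_{ab} ↦ Pm M(E_t) ∧ Pm M(s_{ab}) ∈ ⋀^{|t|} ∧ SI_2 ⊆ SI_{|t|+2}`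
(H9b: equality for `det M ≠ 0`, `k ≤ n`). -/
theorem map_Pm_siegelIdeal_le (M : Matrix (Fin n) (Fin n) K) (k : ℕ) : (siegelIdeal K n k).map (Pm K (n := n) M).toLinearMap ≤ siegelIdeal K n k := by
  rintro _ ⟨θ, hθ, rfl⟩
  rw [SetLike.mem_coe, siegelIdeal] at hθ
  rw [AlgHom.toLinearMap_apply]
  induction hθ using Submodule.span_induction with
  | mem x hx => obtain ⟨p, rfl⟩ := hx; exact Pm_igen_mem_siegelIdeal K M p
  | zero => rw [map_zero]; exact Submodule.zero_mem _
  | add x y _ _ hx hy => rw [map_add]; exact Submodule.add_mem _ hx hy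
  | smul c x _ hx => rw [map_smul]; exact Submodule.smul_mem _ _ hx

/-- membership form. -/
theorem Pm_mem_siegelIdeal (M : Matrix (Fin n) (Fin n) K) {k : ℕ} {θ : HT K (In n)} (hθ : θ ∈ siegelIdeal K n k) : Pm K M θ ∈ siegelIdeal K n k :=
  map_Pm_siegelIdeal_le K M k ⟨θ, hθ, rfl⟩

/-- **`Pm M θ ∧ w_n(q) = 0` for `θ ∈ SI_k`, EVERY `M` (singular included) and every `q`** — for `det M = 0` this is NOT a consequence of `Pm M (w_n q) = det M · w_n q`. -/
theorem Pm_mul_w_eq_zero_of_mem_siegelIdeal (M : Matrix (Fin n) (Fin n) K) {k : ℕ} {θ : HT K (In n)} (hθ : θ ∈ siegelIdeal K n k) (q : ℕ → K) :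
    Pm K M θ * w K n n q = 0 :=
  mul_w_eq_zero_of_mem_siegelIdeal K (Pm_mem_siegelIdeal K M hθ) q

/-- **the Siegel ideal is stable under the whole monoid `M₂(K) × M_n(K)`**: `Sb α β γ δ (Pm M θ) ∈ SI_k` for `θ ∈ SI_k`, every substitution of the letters (H1b) and every pair mixing. -/
theorem Sb_Pm_mem_siegelIdeal (α β γ δ : K) (M : Matrix (Fin n) (Fin n) K) {k : ℕ} {θ : HT K (In n)} (hθ : θ ∈ siegelIdeal K n k) :
    Sb K α β γ δ (Pm K M θ) ∈ siegelIdeal K n k :=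
  map_Sb_siegelIdeal_le K α β γ δ k ⟨Pm K M θ, Pm_mem_siegelIdeal K M hθ, rfl⟩

end Summit.Ventures.HSemireg.Wedge.HankelPairMixing
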